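import Summits.Ventures.HSemireg.WedgeHankelRecurrenceProny

/-!
# Venture HSemireg — PRONY SYNTHESIS (the converse of N19): **if the node polynomial `Π_i (X − λ_i)` of `r` distinct nodes is a recurrence of `q` of window `r + 1` on `[0, N]`,
# then `q_j = Σ_i A_i λ_i^j` on `[0, N]` for unique weights `A`** — a monic recurrence continues uniquely from `r` initial values, and the Vandermonde system supplies the weights;
# hence the WARING-RANK CRITERION «`q` is an `r`-secant sequence with distinct affine nodes iff some product of `r` distinct linear factors lies in `Rec_r(q)`», and (N19) the node set
# and the weights of such a representation are unique for `2r ≤ N + 1`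

HONEST FRAMING. Part of the Lean index of the computation cell `pub-hsemireg` (seat p10 gen 26, Sunday typer «UNIFORM-IN-n»).
LINEAR ALGEBRA OF HANKEL (catalecticant) MATRICES and of polynomials over a field ONLY: no variety, no cohomology theory, no sheaf, no Ext group and no semiregularity map is constructed
here; nothing here says that HC / HC_CM / HC_AV holds; no Literature fact is declared or used.  Custodian versions as in `WedgeHankelSiegelIdeal` (1/3); the dictionary (`secSeq A λ` =
the `r`-secant class `Σ_i A_i exp(λ_i Θ)`; «Waring rank `≤ r` with distinct affine nodes»; Prony's / Sylvester's method) is QUOTED, never asserted.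

WHAT IS IN THE TREE / KEYED.  N18 (`WedgeHankelRecurrenceModule`, № 173): `hkFun`, `recSpace`, `hkFun_eq_sum_range`, `hkFun_add_seq`, `hkFun_smul_seq`; N19 (`WedgeHankelRecurrenceProny`,
№ 174): `prod_X_sub_C_mem_recSpace_secSeq`, `natDegree_prod_X_sub_C_nodes`, `prod_X_sub_C_nodes_ne_zero`, `roots_eq_of_mem_recSpace_secSeq`; D1 (`WedgeHankelSecantRank`, tree) `secSeq`,
`wNodeMat`, `transpose_mulVecLin_injective`.  Mathlib: `Matrix.vandermonde`, `Matrix.det_vandermonde_ne_zero_iff`, `Matrix.nonsing_inv_mul`, `Polynomial.Monic.coeff_natDegree`.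
THIS FILE (namespace `Summit.Ventures.HSemireg.Wedge.HankelOuter` continued; CHAINED on N19; 0 definitions):
* §483 `recSpace_congr` (`Rec_k(q)` reads `q` on `[0, N]` only), `hkFun_monic_eq` (`⟪m, u⟫_s = u_{r+s} + Σ_{i<r} m_i u_{i+s}` for monic `m` of degree `r`), **`eq_zero_of_monic_recurrence`**,
  **`eq_of_monic_recurrence`** (UNIQUE CONTINUATION: two sequences killed by the same monic degree-`r` recurrence on `[0, N]` and equal on `[0, r)` are equal on `[0, N]`),
  `hkFun_eq_zero_of_mem_recSpace`.
* §484 `exists_weights_eq_on_lt` (the Vandermonde system `Σ_i A_i λ_i^j = x_j`, `j < r`, is solvable for distinct nodes), **`exists_secSeq_of_prod_X_sub_C_mem_recSpace`** (PRONY SYNTHESIS: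
  `Π_i (X − λ_i) ∈ Rec_r(q)`, nodes distinct ⇒ `∃ A, ∀ j ≤ N, q_j = secSeq A λ j`), **`exists_weights_iff_prod_X_sub_C_mem_recSpace`** (fixed distinct nodes: `q` is SOME secant sequence on
  them on `[0, N]` iff the node polynomial is a recurrence), **`exists_secSeq_iff_exists_split_recurrence`** (THE WARING-RANK CRITERION: an `r`-term representation with distinct affine
  nodes exists iff a product of `r` distinct linear factors lies in `Rec_r(q)`).
* §485 **`weights_unique`** (`r ≤ N + 1`: the weights on given distinct nodes are determined by `q|[0,N]`), **`nodes_unique`** (`2r ≤ N + 1`, non-zero weights: two `r`-secant sequences equal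
  on `[0, N]` have the same node set — N19's roots of the common minimal recurrence).
READING: N19 analysed a given secant class; this file synthesises it from `2r ≤ N + 1` coefficients — existence by continuation of the recurrence, uniqueness of nodes (as a set) and
weights.  For `r > N` everything is interpolation and the statements are trivially true.  Nothing Ext-side.  New names only.
-/

open Module Polynomial
open scoped Matrix Polynomial

namespace Summit.Ventures.HSemireg.Wedge.HankelOuter

open Summit.Ventures.HSemireg.Wedge Summit.Ventures.HSemireg.Wedge.Hankel Summit.Ventures.HSemireg.Wedge.HankelSecant

variable (K : Type*) [Field K] {N : ℕ}

/-! ## §483. A monic recurrence of window `r + 1` on `[0, N]` determines the sequence from its first `r` values -/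

/-- the recurrence space only reads `q` on `[0, N]`. -/
theorem recSpace_congr {q q' : ℕ → K} (h : ∀ j ≤ N, q j = q' j) (k : ℕ) : recSpace K N q k = recSpace K N q' k := by
  ext p
  simp only [mem_recSpace_iff]
  refine and_congr_right fun hp => forall_congr' fun s => forall_congr' fun hs => ?_
  have hdeg : p.natDegree < k + 1 := Nat.lt_succ_of_le ((mem_degreeLT_succ_iff K).mp hp)
  rw [hkFun_eq_sum_range K q s hdeg, hkFun_eq_sum_range K q' s hdeg,
    Finset.sum_congr rfl fun i hi => by rw [h (i + s) (by have := Finset.mem_range.mp hi; omega)]]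

/-- `⟪m, u⟫_s` for a monic `m` of degree `r`: the leading term isolated, `⟪m, u⟫_s = u_{r+s} + Σ_{i<r} m_i u_{i+s}`. -/
theorem hkFun_monic_eq {r : ℕ} {m : K[X]} (hm : m.Monic) (hmr : m.natDegree = r) (u : ℕ → K) (s : ℕ) :
    hkFun K u s m = u (r + s) + ∑ i ∈ Finset.range r, m.coeff i * u (i + s) := by
  rw [hkFun_eq_sum_range K u s (n := r + 1) (by omega), Finset.sum_range_succ, ← hmr, hm.coeff_natDegree, one_mul, hmr, add_comm]

/-- **a sequence killed on `[0, N]` by a MONIC recurrence of degree `r` and vanishing on `[0, r)` vanishes on `[0, N]`.** -/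
theorem eq_zero_of_monic_recurrence {r : ℕ} {m : K[X]} (hm : m.Monic) (hmr : m.natDegree = r) {u : ℕ → K}
    (hrec : ∀ s, s + r ≤ N → hkFun K u s m = 0) (h0 : ∀ j < r, u j = 0) : ∀ j ≤ N, u j = 0 := by
  intro j
  induction j using Nat.strong_induction_on with
  | _ j ih =>
    intro hj
    rcases Nat.lt_or_ge j r with hlt | hle
    · exact h0 j hlt
    · obtain ⟨s, rfl⟩ := Nat.exists_eq_add_of_le' hle
      have h := hrec s (by omega)
      rw [hkFun_monic_eq K hm hmr, Finset.sum_eq_zero fun i hi => by rw [ih (i + s) (by have := Finset.mem_range.mp hi; omega) (by have := Finset.mem_range.mp hi; omega), mul_zero],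
        add_zero] at h
      rwa [add_comm] at h

/-- **UNIQUENESS OF CONTINUATION: two sequences satisfying the same monic recurrence of degree `r` on `[0, N]` and agreeing on `[0, r)` agree on `[0, N]`.** -/
theorem eq_of_monic_recurrence {r : ℕ} {m : K[X]} (hm : m.Monic) (hmr : m.natDegree = r) {u v : ℕ → K}
    (hu : ∀ s, s + r ≤ N → hkFun K u s m = 0) (hv : ∀ s, s + r ≤ N → hkFun K v s m = 0) (h0 : ∀ j < r, u j = v j) : ∀ j ≤ N, u j = v j := by
  have h := eq_zero_of_monic_recurrence K (N := N) hm hmr (u := u + (-1 : K) • v)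
    (fun s hs => by rw [hkFun_add_seq, hkFun_smul_seq, hu s hs, hv s hs]; ring)
    (fun j hj => by rw [Pi.add_apply, Pi.smul_apply, smul_eq_mul, h0 j hj]; ring)
  intro j hj
  have := h j hj
  rw [Pi.add_apply, Pi.smul_apply, smul_eq_mul] at this
  linear_combination this

/-- a member of `Rec_k(q)` gives the recurrence relations (spelled out for later use). -/
theorem hkFun_eq_zero_of_mem_recSpace {k : ℕ} {q : ℕ → K} {p : K[X]} (hp : p ∈ recSpace K N q k) : ∀ s, s + k ≤ N → hkFun K q s p = 0 :=
  ((mem_recSpace_iff K).mp hp).2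

/-! ## §484. Prony synthesis: a recurrence with `r` distinct roots forces the `r`-secant class on those nodes -/

/-- the Vandermonde system for the weights is solvable: distinct nodes, any `r` prescribed initial values. -/
theorem exists_weights_eq_on_lt {r : ℕ} {lam : Fin r → K} (hlam : Function.Injective lam) (x : Fin r → K) :
    ∃ A : Fin r → K, ∀ j : Fin r, secSeq K A lam j = x j := by
  have hdet : IsUnit (Matrix.vandermonde lam).det := isUnit_iff_ne_zero.mpr (Matrix.det_vandermonde_ne_zero_iff.mpr hlam)
  refine ⟨x ᵥ* (Matrix.vandermonde lam)⁻¹, fun j => ?_⟩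
  have h := congrFun (show x ᵥ* (Matrix.vandermonde lam)⁻¹ ᵥ* Matrix.vandermonde lam = x by
    rw [Matrix.vecMul_vecMul, Matrix.nonsing_inv_mul _ hdet, Matrix.vecMul_one]) j
  rw [← h]
  simp only [secSeq, Matrix.vecMul, dotProduct, Matrix.vandermonde_apply]

/-- **PRONY SYNTHESIS: if the NODE POLYNOMIAL `Π_i (X − λ_i)` of `r` distinct nodes is a recurrence of `q` (window `r + 1` on `[0, N]`), then `q` IS the `r`-secant sequence
`Σ_i A_i λ_i^j` on `[0, N]` for suitable weights `A`** (the weights solve the Vandermonde system on `[0, r)`; the recurrence continues both sides identically; for `r > N` the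
hypothesis is empty and the statement is interpolation). -/
theorem exists_secSeq_of_prod_X_sub_C_mem_recSpace {r : ℕ} {lam : Fin r → K} (hlam : Function.Injective lam) {q : ℕ → K}
    (hm : (∏ i, (Polynomial.X - Polynomial.C (lam i))) ∈ recSpace K N q r) : ∃ A : Fin r → K, ∀ j ≤ N, q j = secSeq K A lam j := by
  obtain ⟨A, hA⟩ := exists_weights_eq_on_lt K hlam (fun j : Fin r => q j)
  refine ⟨A, eq_of_monic_recurrence K (Polynomial.monic_prod_of_monic _ _ fun i _ => Polynomial.monic_X_sub_C (lam i)) (natDegree_prod_X_sub_C_nodes K lam)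
    (hkFun_eq_zero_of_mem_recSpace K hm) (hkFun_eq_zero_of_mem_recSpace K (prod_X_sub_C_mem_recSpace_secSeq K (N := N) A lam)) fun j hj => ?_⟩
  exact (hA ⟨j, hj⟩).symm

/-- **… and conversely** (any weights): `q` agrees on `[0, N]` with SOME `r`-secant sequence on the distinct nodes `λ_i` **iff `Π_i (X − λ_i) ∈ Rec_r(q)`**. -/
theorem exists_weights_iff_prod_X_sub_C_mem_recSpace {r : ℕ} {lam : Fin r → K} (hlam : Function.Injective lam) (q : ℕ → K) :
    (∃ A : Fin r → K, ∀ j ≤ N, q j = secSeq K A lam j) ↔ (∏ i, (Polynomial.X - Polynomial.C (lam i))) ∈ recSpace K N q r := by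
  refine ⟨?_, exists_secSeq_of_prod_X_sub_C_mem_recSpace K hlam⟩
  rintro ⟨A, hA⟩
  rw [recSpace_congr K hA]
  exact prod_X_sub_C_mem_recSpace_secSeq K A lam

/-- the WARING-RANK form: **`q` has an `r`-term representation `q_j = Σ_{i<r} A_i λ_i^j` (`j ≤ N`) with distinct nodes iff some product of `r` distinct linear factors is a recurrence of
window `r + 1`** (quoted: Sylvester's criterion for binary forms, affine chart; meaningful for `2r ≤ N + 1`, trivially true for `r > N`). -/
theorem exists_secSeq_iff_exists_split_recurrence {r : ℕ} (q : ℕ → K) :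
    (∃ (lam : Fin r → K) (A : Fin r → K), Function.Injective lam ∧ ∀ j ≤ N, q j = secSeq K A lam j)
      ↔ ∃ lam : Fin r → K, Function.Injective lam ∧ (∏ i, (Polynomial.X - Polynomial.C (lam i))) ∈ recSpace K N q r := by
  constructor
  · rintro ⟨lam, A, hlam, hA⟩
    exact ⟨lam, hlam, (exists_weights_iff_prod_X_sub_C_mem_recSpace K hlam q).mp ⟨A, hA⟩⟩
  · rintro ⟨lam, hlam, hm⟩
    obtain ⟨A, hA⟩ := exists_secSeq_of_prod_X_sub_C_mem_recSpace K hlam hm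
    exact ⟨lam, A, hlam, hA⟩

/-! ## §485. Uniqueness: the weights by Vandermonde, the node set by Prony -/

/-- **the weights are unique**: two weight vectors on the same `r ≤ N + 1` distinct nodes giving the same values on `[0, N]` coincide. -/
theorem weights_unique {r : ℕ} {lam : Fin r → K} (hlam : Function.Injective lam) (hrN : r ≤ N + 1) {A B : Fin r → K}
    (h : ∀ j ≤ N, secSeq K A lam j = secSeq K B lam j) : A = B := by
  have hinj := transpose_mulVecLin_injective (c := r) le_rfl (A := fun _ : Fin r => (1 : K)) (fun _ => one_ne_zero) hlam
  have key : ∀ C : Fin r → K, (wNodeMat (fun _ : Fin r => (1 : K)) lam r)ᵀ.mulVecLin C = fun l : Fin r => secSeq K C lam l := by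
    intro C
    funext l
    rw [Matrix.mulVecLin_apply, Matrix.mulVec_transpose]
    simp only [Matrix.vecMul, dotProduct, wNodeMat_apply, one_mul, secSeq]
  exact hinj (by rw [key, key]; funext l; exact h l (by have := l.2; omega))

/-- **the node SET is unique** (`2r ≤ N + 1`, all weights non-zero): two `r`-secant sequences agreeing on `[0, N]` have the same nodes (the roots of the common minimal recurrence, N19). -/
theorem nodes_unique [DecidableEq K] {r : ℕ} {lam mu : Fin r → K} (hlam : Function.Injective lam) (hmu : Function.Injective mu) {A B : Fin r → K}
    (hA : ∀ i, A i ≠ 0) (hB : ∀ i, B i ≠ 0) (hr : r + r ≤ N + 1) (h : ∀ j ≤ N, secSeq K A lam j = secSeq K B mu j) :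
    Finset.univ.image lam = Finset.univ.image mu := by
  have hm : (∏ i, (Polynomial.X - Polynomial.C (lam i))) ∈ recSpace K N (secSeq K B mu) r := by
    rw [← recSpace_congr K h]
    exact prod_X_sub_C_mem_recSpace_secSeq K A lam
  rw [← roots_eq_of_mem_recSpace_secSeq K hA hlam hr (prod_X_sub_C_mem_recSpace_secSeq K A lam) (prod_X_sub_C_nodes_ne_zero K lam),
    ← roots_eq_of_mem_recSpace_secSeq K hB hmu hr hm (prod_X_sub_C_nodes_ne_zero K lam)]

end Summit.Ventures.HSemireg.Wedge.HankelOuter
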